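import Literature.NumberTheory.EllipticCurves.Cha2005.ShaStructureIrreducible
import HarnessLib

/-!
# Kolyvagin's structure theorem for `Ш(E/K)[p^∞]` under IRREDUCIBILITY of `ρ̄_{E,p}` with NO hypothesis
# on the reduction of `E` at `p` (Matar–Nekovář 2019, Thm. 0.7 read through §0.11; Kolyvagin 1991
# Thm. C/D): the two one-sided consequences of `#Ш(E/K)[p^∞] = p^{2(m₀ − m_∞)}` in McCallum's currency

A. Matar, J. Nekovář, *Kolyvagin's result on the vanishing of `Ш(E/K)[p^∞]` and its consequences for
anticyclotomic Iwasawa theory*, J. Théor. Nombres Bordeaux **31** (2019) 455–501 (doi:10.5802/jtnb.1091;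
held as `paper:doi-10-5802-jtnb-1091`, RE-READ 2026-08-27 at the locators below, store pages p0002–p0004).
PUBLISHED, refereed. Sibling of `ShaIndexBoundIrreducible.lean` (the BOUND: Thm. 0.3 via §0.11, Ш-index
currency) and of `Cha2005/ShaStructureIrreducible.lean` (the STRUCTURE theorem's two halves under
irreducibility in McCallum's `M_r` currency, carrying B. Cha's standing binders `p ∤ d_K`, `p² ∤ N`). THIS
file = Cha's two `def`s VERBATIM with those two binders REMOVED — the form asserted by Matar–Nekovář's
§0.11 (no condition relating `p` to `N` or to `D_K`), needed where `p` is an ADDITIVE prime of `E`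
(`p² ∣ N`: cell `bsd-potss`, rung K8-t′ / K9 shared crux `JetchevIrreducibleReadingByName`, registered stub
`stub_structureIrred`; seat `bsd-potss-k8t-c4` g8).

HONEST FRAMING (cell `bsd-potss`, HOME `run/shared/lean/pub/bsd-potss/`): BSD is not proved by any of this;
this file vendors ONE published assertion as named facts (`def … : Prop`, nothing asserted, D-0014) and
proves nothing (the Cha-binder forms follow from these by dropping two hypotheses). Its consumer is the kernel reduction
`Theorems/KatoDescentTamePotSupersingularJetchevIrreducibleReadingOfStubs.lean` (p502280): Jetchev 2008
Cor. 1.5 in the irreducible / additive-`p` reading ⟸ (this file's upper half) ∧ (the divisibility reading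
of Jetchev Thm. 1.4) ∧ Kolyvagin ∧ modularity.

## The statements in print (verbatim, re-read 2026-08-27)

**§0.1** (p. 455): "Let `E` be an elliptic curve over `ℚ` of conductor `N` and `K` an imaginary quadratic
field of discriminant `D_K` in which all primes dividing `N` split. Fix a modular parameterisation
`φ : X₀(N) ⟶ E` … The basic Heegner point `y_K ∈ E(K)` attached to these data is, by definition, the
trace `y_K := Tr_{H₁/K}(y₁)` of the Heegner point of conductor one". (No hypothesis relating a prime `p`
to `N` is part of the setting.)

**0.6–0.7** (p. 456): "In [17], Kolyvagin proved the following structure theorem for the group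
`Ш(E/K)[p^∞]`, which refines Theorem 0.3 (under the "big image" assumption for the `p`-adic Galois
representation `ρ_{E,p} : G_ℚ ⟶ Aut_{ℤ_p}(T_p(E)) ≃ GL₂(ℤ_p)`). **0.7. Theorem** (Kolyvagin, [17, Thm. C,
Thm. D]). Assume that `D_K ≠ −3, −4` and that `p ≠ 2` is a prime number for which
`ρ_{E,p} : G_ℚ ⟶ GL₂(ℤ_p)` has "big image" (e.g., that `ρ_{E,p}` is surjective). If `y_K ∉ E(K)_{tors}`,
then `Ш(E/K)[p^∞] ≃ X ⊕ X`, `X ≃ ⊕_{i ≥ 0} ℤ/p^{m_i − m_{i+1}}ℤ`, `m₀ ≥ m₁ ≥ ⋯ ≥ m_∞ := inf m_i`, where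
`m₀` is as in Theorem 0.3 and `m_i` for `i > 0` is defined in a similar way in terms of certain linear
combinations of Heegner points of higher conductors. In particular, `#Ш(E/K)[p^∞] = p^{2(m₀ − m_∞)}`."
([17] = V. A. Kolyvagin, *On the structure of Shafarevich–Tate groups*, Algebraic Geometry (Chicago 1989),
LNM 1479 (1991) 94–121.)

**0.9** (p. 457): "… Therefore the conclusions of Theorems 0.3 and 0.5 hold (for `D_K ≠ −3, −4`) whenever
`p ∤ 2D_K`, `p² ∤ N` and `ρ̄_{E,p}` is irreducible. He [Cha] also showed [3, Thm. 21, Rmk. 25] that the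
statement of Theorem 0.7 holds under the same assumptions." (= the sibling `Cha2005/ShaStructureIrreducible`.)

**0.11** (p. 457): "Lawson and Wuthrich [19] extended and simplified the cohomological calculations of
[3] … In [19, Thm. 1, Thm. 2] they gave a complete classification of pairs `(E, p)` … for which
`H¹(ℚ(E[p])/ℚ, E[p]) ≠ 0` (and similarly for `H¹(ℚ(E[p^n])/ℚ, E[p^n]) ≠ 0`, where `n > 1` and `p > 3`).
… Their results imply that the condition (a) in Theorem 0.3 (for `p ≠ 2`) is always satisfied if
`ρ̄_{E,p}` is irreducible. **Consequently, the conclusions of Theorems 0.3 and 0.7 hold (for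
`D_K ≠ −3, −4`) if `ρ̄_{E,p}` is irreducible and `p ≠ 2`.**" (In-body support for (a): Cor. 5.21 (e′),
pp. 490–491, "`K` is an imaginary quadratic field and `k = 𝔽_p`", and Prop. 5.26 (2), p. 492, "If `ρ` is
irreducible, so is `ρ|_{G_K}`" — as recorded in `ShaIndexBoundIrreducible.lean`.)

McCallum's currency (W. G. McCallum, LMS Lecture Note Ser. 153 (1991) 295–316, §5: `M_r`, Lemma 5.1
`M₀ = ord_p [E(K) : ℤy_K]`, Cor. 5.6 "`ord_p|Ш(E/K)| = 2(M₀ − m)`, `m = min{M_i}`") and its identification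
with Kolyvagin's / Matar–Nekovář's `m_i` are those of the siblings `KolyvaginShaStructureDivisibility.lean`,
`KolyvaginShaStructureCertificate.lean`, `Cha2005/ShaStructureIrreducible.lean` (module docstrings there,
quoted in full), whose tree vocabulary (`KolyvaginHeegnerData`, `derivedPoint`, `Zhang2014.IsKolyvaginPrime`,
`kolyvaginIndex`, `ringClassField`) this file reuses unchanged.

## What is vendored, and how it differs from the siblings (never stronger than print)

The two `def`s below are `Cha2005.rmk25_pow_dvd_card_sha_primary_of_certificate` and
`Cha2005.rmk25_padicValNat_card_sha_primary_add_le_of_globalDivisibility` BYTE-FOR-BYTE with exactly one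
change of binders: Cha's `¬ (p : ℤ) ∣ NumberField.discr K →` and `¬ p ^ 2 ∣ W.conductorNorm ℤ →` are
REMOVED (Matar–Nekovář §0.11 carries neither; their setting §0.1 has no `p`-versus-`N` hypothesis, and
`D_K ≠ −3, −4`, `p ≠ 2`, irreducibility, the Heegner hypothesis, `y_K` of infinite order are kept as
binders). Non-CM is KEPT as a binder (weaker = safer; MN19 do not need it). So each fact here IMPLIES the
corresponding Cha fact (drop two hypotheses) and is implied by nothing in the tree.

REFEREE FLAGS (recorded, not hidden; travel with the facts): `MN19-0.11-structure-composite` — the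
irreducible-image, reduction-free form of the STRUCTURE theorem 0.7 is the authors' §0.11 introduction
sentence ("Consequently, the conclusions of Theorems 0.3 **and 0.7** hold … if `ρ̄_{E,p}` is irreducible
and `p ≠ 2`"), assembling Kolyvagin's [17, Thm. C/D] with Lawson–Wuthrich [19, Thm. 1–2] and their own
Cor. 5.21 (e′) / Prop. 5.26 (2); no line-by-line proof of Thm. 0.7 under irreducibility is printed (the
same standing as the sibling's flag `Cha05-Rmk25-structure` and as flag F1 of
`Jetchev2008/HeegnerIndexTamagawaBoundIrreducible.lean`); `Kolyvagin1991-ThmCD-primary-unread` (LNM 1479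
not held, acq-08093; read through Matar–Nekovář's restatement and McCallum's exposition). The flags'
retirement is the referee's ruling. Nothing is asserted (`def … : Prop`, D-0014); users take
`(h : MatarNekovar2019.thm07_…)`; no `_holds` is expected (size XL: Kolyvagin's Euler system of Heegner
points and the structure theorem, plus the cohomological vanishing of §5 / [19]).

References: [MatarNekovar2019] §0.1 (p. 455), Thm. 0.3, §0.4, §0.6–0.7 (p. 456), §0.9, §0.11 (p. 457),
Cor. 5.21 (e′) (pp. 490–491), Prop. 5.26 (2) (p. 492); [Kolyvagin1991StructureSha] Thm. C, Thm. D;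
[McCallumLMS1991] §4 (S_r(M)), §5 (M_r, Lemma 5.1, Prop. 5.2, Thm. 5.4, Cor. 5.6); [Cha2005] Thm. 21,
Rmk. 25; [LawsonWuthrich2016] Thms. 1–2; [Jetchev2008] §1 (1), Rem. 6.2 (McCallum's proof needs only the
absolute irreducibility of `ρ̄_{E,p}`).
-/

noncomputable section

open scoped Classical

open WeierstrassCurve Literature.NumberTheory.EllipticCurves.ModularForms

namespace Literature.NumberTheory.EllipticCurves.MatarNekovar2019

/-- **Kolyvagin's structure theorem under irreducibility, NO reduction binder at `p` — LOWER half: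
`p^{2(M₀ − M)} ∣ #Ш(E/K)[p^∞]` from ONE level-`(M+1)` certificate** (Matar–Nekovář 2019 Thm. 0.7
"`#Ш(E/K)[p^∞] = p^{2(m₀ − m_∞)}`" read through §0.11 "the conclusions of Theorems 0.3 and 0.7 hold (for
`D_K ≠ −3, −4`) if `ρ̄_{E,p}` is irreducible and `p ≠ 2`", in McCallum's currency: Cor. 5.6 with
`m ≤ M_{ω(n)} ≤ ord_p(P_n) ≤ M` for a certificate `(n, P_n ∉ p^{M+1}E(K_n))`, Lemma 5.1
`M₀ = ord_p[E(K) : ℤy_K]`). TRANSCRIPTION = the sibling `Cha2005.rmk25_pow_dvd_card_sha_primary_of_certificate`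
VERBATIM with Cha's binders `p ∤ d_K`, `p² ∤ N` REMOVED: `W/ℚ` globally minimal without CM,
`N = W.conductorNorm ℤ`, `K` imaginary quadratic with the Heegner hypothesis for `N`, `d_K ∉ {−3, −4}`, `p ≠ 2`
with `E[p]` irreducible, a frame `(Dt, β, ι)`, the conductor-`1` datum `d₁` and `P ∈ E(K)` with the same image
in `E(K̄)` as `P_1 = d₁.derivedPoint` (`P = y_K`), of infinite order, `M₀` with `p^{M₀} ∥ P` in `E(K)`;
CERTIFICATE: a square-free `n` all of whose prime factors are Kolyvagin primes `ℓ` with `M + 1 ≤ M(ℓ)`, and a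
Kolyvagin–Heegner datum `d` of conductor `n` with `P_n = d.derivedPoint ∉ p^{M+1} E(K_n)`. CONCLUSION:
`p ^ (2 (M₀ − M)) ∣ #Ш(E_K/K)[p^∞]`. No hypothesis on the reduction of `E` at `p` (`p ∣ N`, `p² ∣ N` allowed),
no `p ∤ d_K`. Flags `MN19-0.11-structure-composite`, `Kolyvagin1991-ThmCD-primary-unread` (module docstring).
Size XL; no `_holds`.
[cite: MatarNekovar2019, Thm. 0.7 (p. 456), §0.11 (p. 457), §0.1 (p. 455), Cor. 5.21 (e′) (pp. 490–491), Prop. 5.26 (2) (p. 492)]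
[cite: Kolyvagin1991StructureSha, Thm. C, Thm. D]
[cite: McCallumLMS1991, §5 Cor. 5.6 (p. 310), Lemma 5.1 and M_r (p. 303), §4 S_r(M) (pp. 299–300)]
[cite: Cha2005, Rmk. 25 (p. 175)] [cite: Jetchev2008, Rem. 6.2] -/
def thm07_pow_dvd_card_sha_primary_of_certificate_of_irreducible : Prop :=
  ∀ (W : WeierstrassCurve ℚ) [W.IsElliptic] [W.IsGloballyMinimal] [NeZero (W.conductorNorm ℤ)],
    ¬ W.HasCM →
    ∀ (K : Type) [Field K] [NumberField K], IsImaginaryQuadratic K →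
    NumberField.discr K ≠ -3 → NumberField.discr K ≠ -4 →
    SatisfiesHeegnerHypothesis (W.conductorNorm ℤ) K →
    ∀ (p : ℕ) [Fact p.Prime], p ≠ 2 → W.HasIrreducibleModPGaloisRep p →
    ∀ (Dt : ModularParametrizationData W (W.conductorNorm ℤ)) (β : ℤ) (ι : K →+* ℂ)
      (d₁ : KolyvaginHeegnerData Dt β ι 1) (P : (W.baseChange K).toAffine.Point),
      d₁.toGeomPoints d₁.derivedPoint = toGeomPoints (W.baseChange K) P →
      ¬ IsOfFinAddOrder P →
    ∀ (M₀ : ℕ),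
      (∃ Q : (W.baseChange K).toAffine.Point, ((p ^ M₀ : ℕ) : ℤ) • Q = P) →
      (¬ ∃ Q : (W.baseChange K).toAffine.Point, ((p ^ (M₀ + 1) : ℕ) : ℤ) • Q = P) →
    ∀ (n M : ℕ) (d : KolyvaginHeegnerData Dt β ι n), Squarefree n →
      (∀ ℓ ∈ n.primeFactors, Zhang2014.IsKolyvaginPrime (W.conductorNorm ℤ) W K p ℓ ∧
        M + 1 ≤ Zhang2014.kolyvaginIndex W p ℓ) →
      (¬ ∃ Q : (W.baseChange (ringClassField K ι n)).toAffine.Point,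
          ((p ^ (M + 1) : ℕ) : ℤ) • Q = d.derivedPoint) →
    p ^ (2 * (M₀ - M)) ∣ Nat.card (AddCommGroup.primaryComponent (W.baseChange K).sha p)

/-- **Kolyvagin's structure theorem under irreducibility, NO reduction binder at `p` — UPPER half:
`ord_p #Ш(E/K)[p^∞] + 2t ≤ 2M₀` when every derived Heegner point is `p^s`-divisible at every depth `s ≤ t`**
(Matar–Nekovář 2019 Thm. 0.7 read through §0.11 — "the conclusions of Theorems 0.3 and 0.7 hold (for
`D_K ≠ −3, −4`) if `ρ̄_{E,p}` is irreducible and `p ≠ 2`" — in McCallum's currency, Cor. 5.6 with `m ≥ t`;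
the half used in Jetchev 2008's deduction of Cor. 1.5 from Thm. 1.4). TRANSCRIPTION = the sibling
`Cha2005.rmk25_padicValNat_card_sha_primary_add_le_of_globalDivisibility` VERBATIM with Cha's binders
`p ∤ d_K`, `p² ∤ N` REMOVED (binders otherwise as in `thm07_pow_dvd_card_sha_primary_of_certificate_of_irreducible`);
HYPOTHESIS (global divisibility to depth `t`, i.e. `M_∞ ≥ t`): for every `s ≤ t`, every square-free `n` every
prime factor `ℓ` of which is a Kolyvagin prime with `s ≤ M(ℓ)`, and every Kolyvagin–Heegner datum `d` of
conductor `n` on the frame `(Dt, β, ι)`, `P_n = d.derivedPoint ∈ p^s E(K_n)`. CONCLUSION: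
`ord_p #Ш(E_K/K)[p^∞] + 2t ≤ 2M₀`; with `t = 0` this is the `p`-primary Thm. 0.3 bound in frame currency. No
hypothesis on the reduction of `E` at `p` (`p ∣ N`, `p² ∣ N` allowed), no `p ∤ d_K`. It is, verbatim, the
registered stub `stub_structureIrred` of the BSD crux `JetchevIrreducibleReadingByName` (cell `bsd-potss`).
Flags `MN19-0.11-structure-composite`, `Kolyvagin1991-ThmCD-primary-unread` (module docstring). Size XL; no
`_holds`.
[cite: MatarNekovar2019, Thm. 0.7 (p. 456), §0.11 (p. 457), §0.1 (p. 455), Cor. 5.21 (e′) (pp. 490–491), Prop. 5.26 (2) (p. 492)]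
[cite: Kolyvagin1991StructureSha, Thm. C, Thm. D]
[cite: McCallumLMS1991, §5 Cor. 5.6 (p. 310), definition of M_r and ord_p(P_n) and Lemma 5.1 (p. 303); §4 S_r(M) (pp. 299–300)]
[cite: Cha2005, Rmk. 25 (p. 175)] [cite: Jetchev2008, §1 (1) and Cor. 1.5, Rem. 6.2] -/
def thm07_padicValNat_card_sha_primary_add_le_of_globalDivisibility_of_irreducible : Prop :=
  ∀ (W : WeierstrassCurve ℚ) [W.IsElliptic] [W.IsGloballyMinimal] [NeZero (W.conductorNorm ℤ)],
    ¬ W.HasCM →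
    ∀ (K : Type) [Field K] [NumberField K], IsImaginaryQuadratic K →
    NumberField.discr K ≠ -3 → NumberField.discr K ≠ -4 →
    SatisfiesHeegnerHypothesis (W.conductorNorm ℤ) K →
    ∀ (p : ℕ) [Fact p.Prime], p ≠ 2 → W.HasIrreducibleModPGaloisRep p →
    ∀ (Dt : ModularParametrizationData W (W.conductorNorm ℤ)) (β : ℤ) (ι : K →+* ℂ)
      (d₁ : KolyvaginHeegnerData Dt β ι 1) (P : (W.baseChange K).toAffine.Point),
      d₁.toGeomPoints d₁.derivedPoint = toGeomPoints (W.baseChange K) P →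
      ¬ IsOfFinAddOrder P →
    ∀ (M₀ : ℕ),
      (∃ Q : (W.baseChange K).toAffine.Point, ((p ^ M₀ : ℕ) : ℤ) • Q = P) →
      (¬ ∃ Q : (W.baseChange K).toAffine.Point, ((p ^ (M₀ + 1) : ℕ) : ℤ) • Q = P) →
    ∀ (t : ℕ),
      (∀ (s : ℕ), s ≤ t → ∀ (n : ℕ) (d : KolyvaginHeegnerData Dt β ι n), Squarefree n →
        (∀ ℓ ∈ n.primeFactors, Zhang2014.IsKolyvaginPrime (W.conductorNorm ℤ) W K p ℓ ∧
          s ≤ Zhang2014.kolyvaginIndex W p ℓ) →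
        ∃ Q : (W.baseChange (ringClassField K ι n)).toAffine.Point,
          ((p ^ s : ℕ) : ℤ) • Q = d.derivedPoint) →
    padicValNat p (Nat.card (AddCommGroup.primaryComponent (W.baseChange K).sha p)) + 2 * t ≤ 2 * M₀

end Literature.NumberTheory.EllipticCurves.MatarNekovar2019

end
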